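import Summits.CriticalPhenomena.CardyFormulaZ2.Theorems.CardyBoundaryCoulombGasBoundaryDefectGaussianRS18Rainbow22Part1
import Summits.CriticalPhenomena.CardyFormulaZ2.Theorems.CardyBoundaryCoulombGasBoundaryDefectGaussianRStubRealisabilityPart38
import Summits.CriticalPhenomena.CardyFormulaZ2.Theorems.CardyBoundaryCoulombGasRectilinearCardyStubEventIdentityPart3
import Summits.CriticalPhenomena.CardyFormulaZ2.Theorems.CardyBoundaryCoulombGasRectilinearCardyStubEventIdentityPart4

/-!
# The `(2;2)` member of rainbow locality — Part 2: the rainbow event of the `(2;2)` datum IS the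
# two-point connection (crux `BoundaryDefectGaussianR`, stmt-CriticalPhenomena-14132; line
# `rainbow-monomials-in-excursion-kernels`)

For an ADMISSIBLE `(2;2)` datum `ι` (`ι.source = {x}`, `ι.legs x = 2`, sink `y = ι.sink`) on `V` with
FLAT insertion points (radius `sinkLegs + 3`) and radius-`3` boundary CHARTS, and every set `ω` of live
edges (`ω ⊆ inducedEdges V`):

  `ι.Rainbow V ω ↔ x` and `y` are joined by a path of edges of `ω` (inside `V`)

(`s18_rainbow22_iff_conn`, registered; the enumeration `(2;2) ↔ {x ↔ y}` of the module docstring of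
`Literature.Probability.LatticeModels.CollarLegModel`, now a theorem). Write `σ = nextCorner (cfgOf ω)`
(`cfgOf ω = ω`, Part 1), `start_x = (x, K_x)`, `finish_x = (x, K_x + 3)` (and likewise at `y`) for the
four strand ends of Part 1 (`r22_mem_strandEnds_iff`); `σ finish = start` at both points (the exterior
edge is closed), the two starts target live boundary edges (flatness) so they are not cuts, and every
tracked cut is an end (`tc_trackedCuts_are_ends`, …StubRealisabilityPart38): the only cuts a strand can
meet are the two finishes.

* (⇒) `r22_conn_of_rainbow`: the two ends tagged `-1` sit at `y` and at `x`; `Rainbow` joins them by a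
  strand, whose consecutive corners share their vertex or an open edge (`ei_reachable_of_joined`).
* (⇐) `r22_rainbow_of_conn`: the loops ↔ clusters dictionary. `start_y` lies on the `σ`-orbit of
  `start_x` (`ei_mem_orbit_of_wind`, …RectilinearCardyStubEventIdentityPart3): its vertex `y` is joined
  to `x` by open edges (hypothesis), and its face — the collar face after the sink's dart — is joined to
  the face of `start_x` — the collar face after the source's dart — by the chain of collar faces of the
  FREE stretch of the boundary walk from the source back to the sink, consecutive ones separated by a
  closed exterior edge (`ei_faceChain_of_free`, …Part4; the `(2;2)` collar has no arc at all). Hence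
  `finish_y = σ⁻¹ start_y` is on the orbit of `start_x` and `finish_x` on that of `start_y`; following
  `σ` from a start up to the FIRST visit of the opposite finish meets no cut (`r22_joined_of_firstVisit`:
  the own finish would close the orbit up too early), which is `Joined`, i.e. the rainbow event.

All [folklore] over the definitions and the landed strand library; no new objects.
-/

namespace Summit.CriticalPhenomena.CardyFormulaZ2.Cruxes.BoundaryDefectGaussianR.RainbowMonomialsInExcursionKernels

open Finset Function Literature.Probability.LatticeModels Literature.Probability.LatticeModels.CollarLegModel
open Literature.Probability.Percolation
open Summit.CriticalPhenomena.CardyFormulaZ2.Cruxes.RectilinearCardy.ExcursionKernelCovariance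

/-! ### First visits along an orbit of the turning rule -/

section FirstVisit

variable {M : CollarLegModel} {ω : Finset ((ℤ × ℤ) × Bool)}

/-- **First visit is a strand.** Along the orbit of a corner `a` all of whose corners are tracked, let
`σ^n a = b` be the FIRST visit of `b`; if every cut met strictly before is a corner whose successor is `a`
itself, then NO cut is met before (such a cut would close the orbit up before `b`), `n ≤ 4·#vertexCells`
(the corners before the first visit are distinct), and `M.Joined ω a b`. [folklore] -/
theorem r22_joined_of_firstVisit {a b : Site 2 × Fin 4} (htr : ∀ m, M.IsTracked ((nextCorner (M.cfgOf ω))^[m] a))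
    {n : ℕ} (hn : (nextCorner (M.cfgOf ω))^[n] a = b) (hmin : ∀ m < n, (nextCorner (M.cfgOf ω))^[m] a ≠ b)
    (hcut : ∀ m < n, M.IsCut ((nextCorner (M.cfgOf ω))^[m] a) →
      nextCorner (M.cfgOf ω) ((nextCorner (M.cfgOf ω))^[m] a) = a) :
    M.Joined ω a b := by
  -- a period `q ≤ n` of `a` contradicts the minimality of `n`
  have noPeriod : ∀ q, 0 < q → q ≤ n → (nextCorner (M.cfgOf ω))^[q] a ≠ a := by
    intro q hq hqn hper
    have hp : IsPeriodicPt (nextCorner (M.cfgOf ω)) q a := hper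
    have h1 := hp.iterate_mod_apply n
    rw [hn] at h1
    exact hmin (n % q) (lt_of_lt_of_le (Nat.mod_lt _ hq) hqn) h1
  have hnocut : ∀ m < n, ¬M.IsCut ((nextCorner (M.cfgOf ω))^[m] a) := by
    intro m hm hc
    refine noPeriod (m + 1) (Nat.succ_pos m) hm ?_
    rw [iterate_succ_apply']
    exact hcut m hm hc
  have hbound : n ≤ 4 * M.vertexCells.card := by
    by_contra hlt
    push Not at hlt
    obtain ⟨i, j, hij, hj, hEq⟩ := exists_lt_iterate_eq (c₀ := a) (K := n - 1) (fun m _ => htr m) (by omega)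
    exact noPeriod (j - i) (by omega) (by omega) (iterate_sub_eq_self hij hEq)
  exact ⟨n, hbound, hn, hnocut⟩

/-- On a periodic orbit, membership is symmetric. [folklore] -/
theorem r22_exists_iterate_symm {β : BondConfig (Site 2)} {a b : Site 2 × Fin 4}
    (ha : a ∈ periodicPts (nextCorner β)) (hab : ∃ m, (nextCorner β)^[m] a = b) :
    ∃ m, (nextCorner β)^[m] b = a := by
  obtain ⟨m, rfl⟩ := hab
  have hb : (nextCorner β)^[m] a ∈ periodicPts (nextCorner β) := by
    obtain ⟨q, hq, hper⟩ := mem_periodicPts.1 ha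
    exact mem_periodicPts.2 ⟨q, hq, hper.apply_iterate m⟩
  exact (sameCycle_cornerPerm_iff hb).1 (((sameCycle_cornerPerm_iff ha).2 ⟨m, rfl⟩).symm)

end FirstVisit

/-! ### Open edges of `ω` read in `Site 2` -/

section Sites

/-- The vertices of a walk of open edges of `ω ⊆ inducedEdges V` starting in `V` stay in `V`. [folklore] -/
theorem r22_support_subset {V : Finset (ℤ × ℤ)} {ω : Finset ((ℤ × ℤ) × Bool)} (hω : ω ⊆ inducedEdges V) :
    ∀ {u v : Site 2} (p : (openGraph (↑(ω.image edgeSym2) : Set (Sym2 (Site 2)))).Walk u v),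
      u ∈ (↑(V.image toSite) : Set (Site 2)) → ∀ w ∈ p.support, w ∈ (↑(V.image toSite) : Set (Site 2))
  | _, _, .nil, hu => by simpa using hu
  | u, _, .cons (v := v') hadj p, hu => by
    intro w hw
    rw [SimpleGraph.Walk.support_cons, List.mem_cons] at hw
    rcases hw with rfl | hw
    · exact hu
    · refine r22_support_subset hω p ?_ w hw
      rw [openGraph_adj] at hadj
      obtain ⟨he, -⟩ := hadj
      rw [Finset.mem_coe, mem_image] at he
      obtain ⟨e, he, hEq⟩ := he
      have hE := hω he
      rw [inducedEdges, mem_filter] at hE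
      rw [edgeSym2] at hEq
      rw [Finset.mem_coe, mem_image]
      rcases Sym2.eq_iff.1 hEq with ⟨-, h2⟩ | ⟨h1, -⟩
      · exact ⟨_, hE.2.2, h2⟩
      · exact ⟨_, hE.2.1, h1⟩

/-- The open graph of `ω ⊆ inducedEdges V` is a subgraph of `ℤ²`. [folklore] -/
theorem r22_openGraph_le {ω : Finset ((ℤ × ℤ) × Bool)} :
    openGraph (↑(ω.image edgeSym2) : Set (Sym2 (Site 2))) ≤ zdGraph 2 := by
  intro a b hab
  rw [openGraph_adj, Finset.mem_coe, mem_image] at hab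
  obtain ⟨⟨e, -, hEq⟩, -⟩ := hab
  rw [← SimpleGraph.mem_edgeSet, ← hEq, ← cTgt_cIn e]
  exact cTgt_mem_edgeSet _

end Sites

/-! ### The `(2;2)` datum: starts, finishes and cuts -/

section Ends

variable (ι : LegInsertionData) (V : Finset (ℤ × ℤ)) {x : ℤ × ℤ} (hsrc : ι.source = {x})
  (hlegs : ι.legs x = 2) (hadm : ι.IsAdmissible V)
  (hflat : ∀ z ∈ insert ι.sink ι.source, ∃ dvec : ℤ × ℤ,
    (dvec = (1, 0) ∨ dvec = (-1, 0) ∨ dvec = (0, 1) ∨ dvec = (0, -1)) ∧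
    ∀ v : ℤ × ℤ, (v.1 - z.1) ^ 2 + (v.2 - z.2) ^ 2 ≤ ((ι.sinkLegs : ℤ) + 3) ^ 2 →
      (v ∈ V ↔ 0 ≤ (v.1 - z.1) * dvec.1 + (v.2 - z.2) * dvec.2))

include hadm hflat in
/-- **A flat insertion point**: its exterior dart `(z, K)`, the next boundary vertex `z + dir (K+1)`
in `V`, the ghost `z + dir K` outside. [folklore] -/
theorem r22_point {z : ℤ × ℤ} (hz : z ∈ insert ι.sink ι.source) :
    ∃ K : Fin 4, outDart V z = some (z, K) ∧ z ∈ V ∧ z + dir K ∉ V ∧ z + dir (K + 1) ∈ V := by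
  obtain ⟨K, hout, hch⟩ := se_chart_of_mem ι V hadm hflat hz
  have hL : (1 : ℤ) ≤ (ι.sinkLegs : ℤ) + 1 := by have := sinkLegs_pos ι V hadm; omega
  refine ⟨K, hout, ?_, (s3_outDart_some V z _ hout).2, ?_⟩
  · have e : z = z + (0 : ℤ) • dir (K + 1) + (0 : ℤ) • dir K := by module
    rw [e]; exact (hch 0 0 (by norm_num) (by omega) (by norm_num) (by norm_num)).2 le_rfl
  · have e : z + dir (K + 1) = z + (1 : ℤ) • dir (K + 1) + (0 : ℤ) • dir K := by module
    rw [e]; exact (hch 1 0 (by norm_num) hL (by norm_num) (by norm_num)).2 le_rfl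

variable {ω : Finset ((ℤ × ℤ) × Bool)} (hω : ω ⊆ inducedEdges V)

include hsrc hlegs hadm hω in
/-- **The exterior edge at a boundary vertex is closed** in the completed configuration of `ω`, so
the turning rule maps the finish `(z, K + 3)` to the start `(z, K)`. [folklore] -/
theorem r22_next_finish {z : ℤ × ℤ} {K : Fin 4} (hz : z ∈ V) (htip : z + dir K ∉ V) :
    nextCorner ((ι.model V).cfgOf ω) (toSite z, K + 3) = (toSite z, K) := by
  have hK : K + 3 + 1 = K := by fin_cases K <;> rfl
  have harc : z ∉ (ι.model V).arcVerts := by rw [(r22_cells ι V hsrc hlegs hadm).1]; simp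
  have hcl := ei_exteriorEdge_not_mem_cfgOf (M := ι.model V) hω hz htip harc
  have hct : cTgt (toSite z, K + 3) = s(toSite z, toSite z + cornerUnit K) := by rw [cTgt, hK]
  rw [nextCorner_of_not_mem (by rw [hct]; exact hcl), hK]

include hsrc hlegs hadm in
/-- **All corners of the orbit of a corner at a vertex of `V` are tracked.** [folklore] -/
theorem r22_isTracked_iterate (hω : ω ⊆ inducedEdges V) {v : ℤ × ℤ} (hv : v ∈ V) (k : Fin 4) (m : ℕ) :
    (ι.model V).IsTracked ((nextCorner ((ι.model V).cfgOf ω))^[m] (toSite v, k)) := by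
  rw [r22_isTracked_iff ι V hsrc hlegs hadm]
  have h := ei_iterate_fst_mem (M := ι.model V) hω (toSite v, k) m
  rw [r22_vertexCells ι V hsrc hlegs hadm] at h
  rcases Set.mem_insert_iff.1 h with h | h
  · rw [h, ofSite_toSite]; exact hv
  · rw [Finset.coe_image, Set.mem_image] at h
    obtain ⟨w, hw, hEq⟩ := h
    rw [← hEq, ofSite_toSite]; exact hw

include hsrc hlegs hadm hflat in
/-- **The cuts a strand can meet.** A tracked cut of the `(2;2)` collar is the finish `(y, K_y + 3)` at
the sink or the finish `(x, K_x + 3)` at the source (tracked cuts are ends, Part 38; the two starts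
target live boundary edges). [folklore] -/
theorem r22_cut_cases
    (hchart : ∀ u ∈ V, ∀ k : Fin 4, u + dir k ∉ V → ∃ (K : Fin 4) (c₁ c₂ : ℤ),
      (∀ v : ℤ × ℤ, |v.1 - u.1| ≤ 3 → |v.2 - u.2| ≤ 3 →
        (v ∈ V ↔ c₂ ≤ v.1 * (dir (K + 1)).1 + v.2 * (dir (K + 1)).2)) ∨
      (∀ v : ℤ × ℤ, |v.1 - u.1| ≤ 3 → |v.2 - u.2| ≤ 3 →
        (v ∈ V ↔ c₁ ≤ v.1 * (dir K).1 + v.2 * (dir K).2 ∧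
          c₂ ≤ v.1 * (dir (K + 1)).1 + v.2 * (dir (K + 1)).2)) ∨
      (∀ v : ℤ × ℤ, |v.1 - u.1| ≤ 3 → |v.2 - u.2| ≤ 3 →
        (v ∈ V ↔ c₂ ≤ v.1 * (dir (K + 1)).1 + v.2 * (dir (K + 1)).2 ∨
          v.1 * (dir K).1 + v.2 * (dir K).2 ≤ c₁)))
    {Ky Kx : Fin 4} (hKy : outDart V ι.sink = some (ι.sink, Ky)) (hKx : outDart V x = some (x, Kx))
    {c : Site 2 × Fin 4} (htr : (ι.model V).IsTracked c) (hcut : (ι.model V).IsCut c) :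
    c = (toSite ι.sink, Ky + 3) ∨ c = (toSite x, Kx + 3) := by
  obtain ⟨m, hm⟩ := tc_trackedCuts_are_ends ι V hadm hflat hchart c htr hcut
  rw [r22_mem_strandEnds_iff ι V hsrc hlegs hadm hKy (st := fun t =>
    List.foldl (fun s d => s.step (ι.startAt V d)) ι.init ((cycle V (ι.sink, Ky)).take t)) (fun _ => rfl) hKx] at hm
  simp only [Prod.mk.injEq] at hm
  -- the two starts target live edges, hence are not cuts
  have hlive : ∀ {z : ℤ × ℤ} {K : Fin 4}, z ∈ insert ι.sink ι.source → outDart V z = some (z, K) →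
      (ι.model V).TargetsLive (toSite z, K) := by
    intro z K hz hK
    obtain ⟨K', hK', hzV, -, hnext⟩ := r22_point ι V hadm hflat hz
    obtain rfl : K' = K := by simpa using hK'.symm.trans hK
    exact (se_targetsLive_iff (ι.model V) z K').2 ⟨hzV, hnext⟩
  rcases hm with ⟨h1, -⟩ | ⟨h1, -⟩ | ⟨h1, -⟩ | ⟨h1, -⟩
  · exact Or.inl h1
  · exact absurd (hlive (mem_insert_self _ _) hKy) (h1 ▸ hcut).1
  · exact Or.inr h1
  · exact absurd (hlive (by rw [hsrc]; simp) hKx) (h1 ▸ hcut).1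

include hsrc hlegs hadm hω in
/-- **Loops ↔ clusters for the `(2;2)` collar**: if `x` and `y = ι.sink` are joined by open edges of
`ω`, the start `(y, K_y)` lies on the orbit of the start `(x, K_x)` under the turning rule of `cfgOf ω`
(winding numbers of the orbit loop: `ei_mem_orbit_of_wind`, with the face chain of the free stretch of
collar faces from the source's dart back to the sink's, `ei_faceChain_of_free`). [cite: BaxterKellandWu1976, §3–§4] -/
theorem r22_start_mem_orbit {Ky Kx : Fin 4} (hKy : outDart V ι.sink = some (ι.sink, Ky))
    (hKx : outDart V x = some (x, Kx))
    (hreach : (openGraph ((ι.model V).cfgOf ω) ⊓ zdGraph 2).Reachable (toSite x) (toSite ι.sink)) :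
    ∃ m, (nextCorner ((ι.model V).cfgOf ω))^[m] (toSite x, Kx) = (toSite ι.sink, Ky) := by
  have hωE : ω ⊆ (ι.model V).E := hω
  have hp := ei_mem_periodicPts (M := ι.model V) hωE (toSite x, Kx)
  refine ei_mem_orbit_of_wind hp ⟨0, rfl⟩ ⟨0, rfl⟩ hreach ?_
  -- the face chain along the free stretch from the source's dart `ds[tₓ]` back to the sink's dart
  obtain ⟨hyV, htip⟩ := sinkDart_exterior ι V hadm hKy
  obtain ⟨tₓ, -, htₓ, hds⟩ := r22_index_x ι V hsrc hadm hKy (st := fun t =>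
    List.foldl (fun s d => s.step (ι.startAt V d)) ι.init ((cycle V (ι.sink, Ky)).take t)) (fun _ => rfl) hKx
  have hP := s3_period_spec V (ι.sink, Ky) hyV htip
  have hlen : (cycle V (ι.sink, Ky)).length = period V (ι.sink, Ky) := by simp [cycle]
  have ha : (dsucc V)^[tₓ] (ι.sink, Ky) = (x, Kx) := by rw [← se_cycle_getElem V htₓ, hds]
  have hb : (dsucc V)^[period V (ι.sink, Ky)] (ι.sink, Ky) = (ι.sink, Ky) := hP.2.2.1
  have hchain := ei_faceChain_of_free (M := ι.model V) hωE (d₀ := (ι.sink, Ky)) hyV htip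
    (a := tₓ) (b := period V (ι.sink, Ky)) (by rw [← hlen]; exact htₓ.le)
    (fun i _ _ => by rw [(r22_cells ι V hsrc hlegs hadm).1]; simp)
  rw [show (ι.model V).V = V from rfl, ha, hb] at hchain
  exact hchain

include hsrc hlegs hadm hflat hω in
/-- **The strand from a start reaches the opposite finish** when the opposite start is on its orbit:
the first visit of the opposite finish meets no cut. [cite: BaxterKellandWu1976, §3–§4] -/
theorem r22_joined_of_mem_orbit
    (hchart : ∀ u ∈ V, ∀ k : Fin 4, u + dir k ∉ V → ∃ (K : Fin 4) (c₁ c₂ : ℤ),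
      (∀ v : ℤ × ℤ, |v.1 - u.1| ≤ 3 → |v.2 - u.2| ≤ 3 →
        (v ∈ V ↔ c₂ ≤ v.1 * (dir (K + 1)).1 + v.2 * (dir (K + 1)).2)) ∨
      (∀ v : ℤ × ℤ, |v.1 - u.1| ≤ 3 → |v.2 - u.2| ≤ 3 →
        (v ∈ V ↔ c₁ ≤ v.1 * (dir K).1 + v.2 * (dir K).2 ∧
          c₂ ≤ v.1 * (dir (K + 1)).1 + v.2 * (dir (K + 1)).2)) ∨
      (∀ v : ℤ × ℤ, |v.1 - u.1| ≤ 3 → |v.2 - u.2| ≤ 3 →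
        (v ∈ V ↔ c₂ ≤ v.1 * (dir (K + 1)).1 + v.2 * (dir (K + 1)).2 ∨
          v.1 * (dir K).1 + v.2 * (dir K).2 ≤ c₁)))
    {Ky Kx : Fin 4} (hKy : outDart V ι.sink = some (ι.sink, Ky)) (hKx : outDart V x = some (x, Kx))
    {a b : ℤ × ℤ} {Ka Kb : Fin 4}
    (hab : (a = x ∧ Ka = Kx ∧ b = ι.sink ∧ Kb = Ky) ∨ (a = ι.sink ∧ Ka = Ky ∧ b = x ∧ Kb = Kx))
    (horb : ∃ m, (nextCorner ((ι.model V).cfgOf ω))^[m] (toSite a, Ka) = (toSite b, Kb)) :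
    (ι.model V).Joined ω (toSite a, Ka) (toSite b, Kb + 3) := by
  classical
  have hωE : ω ⊆ (ι.model V).E := hω
  -- the two points: in `V`, ghosts outside, `σ finish = start`
  obtain ⟨Ky', hKy', hyV, hytip, -⟩ := r22_point ι V hadm hflat (mem_insert_self _ _)
  obtain rfl : Ky' = Ky := by simpa using hKy'.symm.trans hKy
  obtain ⟨Kx', hKx', hxV, hxtip, -⟩ := r22_point ι V hadm hflat (z := x) (by rw [hsrc]; simp)
  obtain rfl : Kx' = Kx := by simpa using hKx'.symm.trans hKx
  have haV : a ∈ V ∧ a + dir Ka ∉ V := by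
    rcases hab with ⟨rfl, rfl, -, -⟩ | ⟨rfl, rfl, -, -⟩ <;> exact ⟨‹_›, ‹_›⟩
  have hbV : b ∈ V ∧ b + dir Kb ∉ V := by
    rcases hab with ⟨-, -, rfl, rfl⟩ | ⟨-, -, rfl, rfl⟩ <;> exact ⟨‹_›, ‹_›⟩
  have hfa : nextCorner ((ι.model V).cfgOf ω) (toSite a, Ka + 3) = (toSite a, Ka) :=
    r22_next_finish ι V hsrc hlegs hadm hω haV.1 haV.2
  have hfb : nextCorner ((ι.model V).cfgOf ω) (toSite b, Kb + 3) = (toSite b, Kb) :=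
    r22_next_finish ι V hsrc hlegs hadm hω hbV.1 hbV.2
  -- the opposite finish is on the orbit; take its first visit
  have hp : (toSite a, Ka) ∈ periodicPts (nextCorner ((ι.model V).cfgOf ω)) :=
    ei_mem_periodicPts (M := ι.model V) hωE _
  have hfin : ∃ n, (nextCorner ((ι.model V).cfgOf ω))^[n] (toSite a, Ka) = (toSite b, Kb + 3) :=
    (exists_iterate_eq_nextCorner_iff hp).1 (by rw [hfb]; exact horb)
  refine r22_joined_of_firstVisit (r22_isTracked_iterate ι V hsrc hlegs hadm hω haV.1 Ka)
    (Nat.find_spec hfin) (fun m hm h => Nat.find_min hfin hm h) fun m hm hc => ?_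
  -- a cut met before is one of the two finishes: not `b`'s (first visit), so `a`'s
  have htr := r22_isTracked_iterate ι V hsrc hlegs hadm hω haV.1 Ka m
  rcases r22_cut_cases ι V hsrc hlegs hadm hflat hchart hKy hKx htr hc with h | h
  · rcases hab with ⟨rfl, rfl, rfl, rfl⟩ | ⟨rfl, rfl, rfl, rfl⟩
    · exact absurd h (Nat.find_min hfin hm)
    · rw [h]; exact hfa
  · rcases hab with ⟨rfl, rfl, rfl, rfl⟩ | ⟨rfl, rfl, rfl, rfl⟩
    · rw [h]; exact hfa
    · exact absurd h (Nat.find_min hfin hm)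

/-! ### The identification -/

include hsrc hlegs hadm hflat hω in
/-- **(⇐) A connection forces the rainbow event**: if `x ↔ y` by open edges of `ω` inside `V`, the
strands from the two starts reach the opposite finishes. [cite: BaxterKellandWu1976, §3–§4] -/
theorem r22_rainbow_of_conn
    (hchart : ∀ u ∈ V, ∀ k : Fin 4, u + dir k ∉ V → ∃ (K : Fin 4) (c₁ c₂ : ℤ),
      (∀ v : ℤ × ℤ, |v.1 - u.1| ≤ 3 → |v.2 - u.2| ≤ 3 →
        (v ∈ V ↔ c₂ ≤ v.1 * (dir (K + 1)).1 + v.2 * (dir (K + 1)).2)) ∨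
      (∀ v : ℤ × ℤ, |v.1 - u.1| ≤ 3 → |v.2 - u.2| ≤ 3 →
        (v ∈ V ↔ c₁ ≤ v.1 * (dir K).1 + v.2 * (dir K).2 ∧
          c₂ ≤ v.1 * (dir (K + 1)).1 + v.2 * (dir (K + 1)).2)) ∨
      (∀ v : ℤ × ℤ, |v.1 - u.1| ≤ 3 → |v.2 - u.2| ≤ 3 →
        (v ∈ V ↔ c₂ ≤ v.1 * (dir (K + 1)).1 + v.2 * (dir (K + 1)).2 ∨
          v.1 * (dir K).1 + v.2 * (dir K).2 ≤ c₁)))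
    (hconn : (↑(ω.image edgeSym2) : Set (Sym2 (Site 2))) ∈
      openConnIn (↑(V.image toSite) : Set (Site 2)) (toSite x) (toSite ι.sink)) :
    ι.Rainbow V ω := by
  classical
  obtain ⟨Ky, hKy, -, -, -⟩ := r22_point ι V hadm hflat (mem_insert_self _ _)
  obtain ⟨Kx, hKx, -, -, -⟩ := r22_point ι V hadm hflat (z := x) (by rw [hsrc]; simp)
  -- reachability in `openGraph (cfgOf ω) ⊓ zdGraph 2`
  have hreach : (openGraph ((ι.model V).cfgOf ω) ⊓ zdGraph 2).Reachable (toSite x) (toSite ι.sink) := by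
    obtain ⟨hx, hy, hr⟩ := hconn
    rw [r22_cfgOf ι V hsrc hlegs hadm, inf_eq_left.2 r22_openGraph_le]
    exact hr.map (SimpleGraph.Embedding.induce _).toHom
  have horb := r22_start_mem_orbit ι V hsrc hlegs hadm hω hKy hKx hreach
  have hpx : (toSite x, Kx) ∈ periodicPts (nextCorner ((ι.model V).cfgOf ω)) :=
    ei_mem_periodicPts (M := ι.model V) hω _
  have hJ1 := r22_joined_of_mem_orbit ι V hsrc hlegs hadm hflat hω hchart hKy hKx
    (Or.inl ⟨rfl, rfl, rfl, rfl⟩) horb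
  have hJ2 := r22_joined_of_mem_orbit ι V hsrc hlegs hadm hflat hω hchart hKy hKx
    (Or.inr ⟨rfl, rfl, rfl, rfl⟩) (r22_exists_iterate_symm hpx horb)
  -- the rainbow event over the four ends
  intro e he e' he' htag hne
  rw [r22_mem_strandEnds_iff ι V hsrc hlegs hadm hKy (st := fun t =>
    List.foldl (fun s d => s.step (ι.startAt V d)) ι.init ((cycle V (ι.sink, Ky)).take t)) (fun _ => rfl) hKx]
    at he he'
  rcases he with rfl | rfl | rfl | rfl <;> rcases he' with rfl | rfl | rfl | rfl
  all_goals first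
    | exact absurd rfl hne
    | exact Or.inl hJ1
    | exact Or.inr hJ1
    | exact Or.inl hJ2
    | exact Or.inr hJ2
    | (exfalso; norm_num at htag)

include hsrc hlegs hadm hflat hω in
/-- **(⇒) The rainbow event forces a connection**: the two ends tagged `-1` sit at `y` and at `x` and
are joined by a strand, whose corners have vertices joined by open edges. [cite: BaxterKellandWu1976, §3–§4] -/
theorem r22_conn_of_rainbow (hR : ι.Rainbow V ω) :
    (↑(ω.image edgeSym2) : Set (Sym2 (Site 2))) ∈
      openConnIn (↑(V.image toSite) : Set (Site 2)) (toSite x) (toSite ι.sink) := by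
  obtain ⟨Ky, hKy, -, -, -⟩ := r22_point ι V hadm hflat (mem_insert_self _ _)
  obtain ⟨Kx, hKx, hxV, -, -⟩ := r22_point ι V hadm hflat (z := x) (by rw [hsrc]; simp)
  have hmem := r22_mem_strandEnds_iff ι V hsrc hlegs hadm hKy (st := fun t =>
    List.foldl (fun s d => s.step (ι.startAt V d)) ι.init ((cycle V (ι.sink, Ky)).take t)) (fun _ => rfl) hKx
  have hB : ((toSite ι.sink, Ky), (-1 : ℤ)) ∈ ι.strandEnds V := (hmem _).2 (Or.inr (Or.inl rfl))
  have hC : ((toSite x, Kx + 3), (-1 : ℤ)) ∈ ι.strandEnds V := (hmem _).2 (Or.inr (Or.inr (Or.inl rfl)))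
  have hne : (toSite ι.sink, Ky) ≠ (toSite x, Kx + 3) := by
    intro h
    have hsx : ι.sink = x := toSite_inj.1 (Prod.mk.inj h).1
    exact hadm.2.2.1 (by rw [hsrc, mem_singleton, hsx])
  have hreach : (openGraph ((ι.model V).cfgOf ω)).Reachable (toSite x) (toSite ι.sink) := by
    rcases hR _ hB _ hC rfl hne with hj | hj
    · exact (ei_reachable_of_joined hj).symm
    · exact ei_reachable_of_joined hj
  rw [r22_cfgOf ι V hsrc hlegs hadm] at hreach
  obtain ⟨p⟩ := hreach
  have hxS : toSite x ∈ (↑(V.image toSite) : Set (Site 2)) := Finset.mem_coe.2 (mem_image_of_mem _ hxV)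
  exact ⟨_, _, ⟨p.induce _ (r22_support_subset hω p hxS)⟩⟩

end Ends

/-! ### Registered form -/

/-- **Sub-goal `s18_rainbow22_iff_conn`** (registered on stmt-CriticalPhenomena-14132; the `(2;2)` member
of the open stub `stub_rainbowLocality`, combinatorial half): for an admissible `(2;2)` datum (one source
`x` with `2` legs, sink `ι.sink`) with flat insertion points and radius-`3` boundary charts, and every
set `ω` of live edges, **the rainbow event of `ω` is the event that `x` and the sink are joined by a path
of edges of `ω` inside `V`** — the enumeration `(2;2) ↔ {x ↔ y}` of the model's validation, as a theorem.
[cite: BaxterKellandWu1976, §3–§4] -/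
theorem s18_rainbow22_iff_conn : ∀ (ι : Literature.Probability.LatticeModels.CollarLegModel.LegInsertionData) (V : Finset (ℤ × ℤ)) (x : ℤ × ℤ), ι.source = {x} → ι.legs x = 2 → ι.IsAdmissible V → (∀ z ∈ insert ι.sink ι.source, ∃ dvec : ℤ × ℤ, (dvec = (1, 0) ∨ dvec = (-1, 0) ∨ dvec = (0, 1) ∨ dvec = (0, -1)) ∧ ∀ v : ℤ × ℤ, (v.1 - z.1) ^ 2 + (v.2 - z.2) ^ 2 ≤ ((ι.sinkLegs : ℤ) + 3) ^ 2 → (v ∈ V ↔ 0 ≤ (v.1 - z.1) * dvec.1 + (v.2 - z.2) * dvec.2)) → (∀ u ∈ V, ∀ k : Fin 4, u + Literature.Probability.LatticeModels.CollarLegModel.dir k ∉ V → ∃ (K : Fin 4) (c₁ c₂ : ℤ), (∀ v : ℤ × ℤ, |v.1 - u.1| ≤ 3 → |v.2 - u.2| ≤ 3 → (v ∈ V ↔ c₂ ≤ v.1 * (Literature.Probability.LatticeModels.CollarLegModel.dir (K + 1)).1 + v.2 * (Literature.Probability.LatticeModels.CollarLegModel.dir (K + 1)).2)) ∨ (∀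 v : ℤ × ℤ, |v.1 - u.1| ≤ 3 → |v.2 - u.2| ≤ 3 → (v ∈ V ↔ c₁ ≤ v.1 * (Literature.Probability.LatticeModels.CollarLegModel.dir K).1 + v.2 * (Literature.Probability.LatticeModels.CollarLegModel.dir K).2 ∧ c₂ ≤ v.1 * (Literature.Probability.LatticeModels.CollarLegModel.dir (K + 1)).1 + v.2 * (Literature.Probability.LatticeModels.CollarLegModel.dir (K + 1)).2)) ∨ (∀ v : ℤ × ℤ, |v.1 - u.1| ≤ 3 → |v.2 - u.2| ≤ 3 → (v ∈ V ↔ c₂ ≤ v.1 * (Literature.Probability.LatticeModels.CollarLegModel.dir (K + 1)).1 + v.2 * (Literature.Probability.LatticeModels.CollarLegModel.dir (K + 1)).2 ∨ v.1 * (Literature.Probability.LatticeModels.CollarLegModel.dir K).1 + v.2 * (Literature.Probability.LatticeModels.CollarLegModel.dir K).2 ≤ c₁))) → ∀ ω ⊆ Literature.Probability.LatticeModels.CollarLegModel.inducedEdges V, (ι.Rainbow V ω ↔ (↑(ω.image Literature.Probability.LatticeModels.CollarLegModel.edgeSym2) : Set (Sym2 (Fin 2 → ℤ))) ∈ Literature.Probability.Percolation.openConnIn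 (↑(V.image (fun v : ℤ × ℤ => (![v.1, v.2] : Fin 2 → ℤ))) : Set (Fin 2 → ℤ)) (![x.1, x.2] : Fin 2 → ℤ) (![ι.sink.1, ι.sink.2] : Fin 2 → ℤ)) := by
  intro ι V x hsrc hlegs hadm hflat hchart ω hω
  exact ⟨r22_conn_of_rainbow ι V hsrc hlegs hadm hflat hω,
    r22_rainbow_of_conn ι V hsrc hlegs hadm hflat hω hchart⟩

end Summit.CriticalPhenomena.CardyFormulaZ2.Cruxes.BoundaryDefectGaussianR.RainbowMonomialsInExcursionKernels
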